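import Literature.AlgebraicGeometry.ShimuraVarieties.UnitaryBallLevelFiniteCover
import Literature.AlgebraicGeometry.ShimuraVarieties.UnitaryBallHeckeTranslation
import Literature.AlgebraicGeometry.HodgeTheory.FiniteDeckTransferHodge
import HarnessLib

/-!
# A normal level pair of compact ball quotients is a finite regular covering with algebraic deck transformations

Let `D₁ : UnitaryBallUniformisationDatum 2 X₁`, `D₂ : UnitaryBallUniformisationDatum 2 X₂` be ball uniformizations
`Γ₁\𝔹² ≅ X₁(ℂ)`, `Γ₂\𝔹² ≅ X₂(ℂ)` of smooth projective surfaces with THE SAME hermitian space (`D₁.Hℂ = D₂.Hℂ`)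
and `Γ₁^{τ₁} ⊴ Γ₂^{τ₁}` a NORMAL subgroup of finite index (read in `GL₃(ℂ)`), and let `f : X₁ ⟶ X₂` be the
level covering (`f(ℂ) (unif₁ v) = unif₂ v`, tree `UnitaryBallLevelCovering.exists_hom_map_unif_eq`).  We PROVE
(`exists_finiteDeckCover`) that `f(ℂ) : X₁(ℂ) → X₂(ℂ)` carries the structure of a finite REGULAR covering in the
sense of the tree's `FiniteDeckCover` (`AlgebraicTopology/SingularHomology/FiniteDeckTransfer`) with deck group
`G = Γ₂^{τ₁} / Γ₁^{τ₁}` acting on `X₁(ℂ)` by `[γ] · unif₁ v = unif₁ (γ v)`, EVERY deck transformation being the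
map on complex points of an algebraic automorphism `φ_γ : X₁ ⟶ X₁` (the Hecke translation `[v] ↦ [γ v]`,
tree `UnitaryBallHeckeTranslation.exists_hom_map_unif_mulVec_eq`).  Ingredients, all tree theorems: `f(ℂ)` is a
covering map and onto (`UnitaryBallLevelFiniteCover.isCoveringMap_of_unif_comp`, `surjective_of_unif_comp`;
Borel's proper discontinuity), the fibres of `unifᵢ` are the `Γᵢ·ℂˣ`-orbits (field `unif_eq_unif_iff`), and
the record `Arapura2012_Cor_15_4_6` (a tree theorem, `arapura2012_cor_15_4_6_holds`; kept as a hypothesis as in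
the two sibling files, to stay on their import cone).

Consequence (`exists_finiteDeckCover_transferMap_hodge`, with `HodgeTheory/FiniteDeckTransferHodge`): the
transfer `τ^* : Hᵏ(X₁(ℂ); ℚ) → Hᵏ(X₂(ℂ); ℚ)` of the level covering PRESERVES THE HODGE FILTRATIONS of record, and
every Hecke-shaped operator `τ^* ∘ f₂^*` (`f₂ : X₁ ⟶ X₂` any morphism, e.g. a Hecke translation followed by a
level map) is a HODGE ENDOMORPHISM of `Hᵏ(X₂(ℂ); ℚ)` — kernel task (a) of the cell `pub-hodgecm2`'s route R-A
(ROUTES v5.11 (a¹²)(ii′)): the hypothesis `hH` of `Motives.HodgeStructure.Polarization.isSemisimple_apply` for the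
Hecke algebra of the tower of ball quotients.  THEOREMS ONLY (the action, the covering structure and the deck
morphisms are produced inside an existential; no definition, no named fact, sorry-free).  Count-neutral.

## Sources

* G. Shimura, *Introduction to the Arithmetic Theory of Automorphic Functions* (1971), §3.1 (commensurable
  groups, `Γ' ⊴ Γ` of finite index), §7.2–7.3 (the two projections of a modular correspondence are morphisms).
* N. Bergeron, J. Millson, C. Moeglin, *The Hodge conjecture and arithmetic quotients of complex balls*, Acta
  Math. 216 (2016), Introduction §1.1 and Part 2 §1.3, §1.8 (the tower `S(Γ)` of compact ball quotients; Hecke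
  correspondences act as algebraic correspondences).
* A. Hatcher, *Algebraic Topology* (2002), §1.3 Prop. 1.39–1.40 (normal coverings: the deck group of
  `Γ₁\𝔹 → Γ₂\𝔹` is `Γ₂/Γ₁`, acting transitively on the fibres).
* D. Arapura, *Algebraic Geometry over the Complex Numbers* (2012), §15.4 Cor. 15.4.6.

## References

* [Shimura1971] G. Shimura, Introduction to the Arithmetic Theory of Automorphic Functions, 1971, §3.1, §7.2–7.3.
* [BergeronMillsonMoeglin2016Balls] N. Bergeron, J. Millson, C. Moeglin, Acta Math. 216 (2016), Introduction
  §1.1, Part 2 §1.3, §1.8.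
* [HatcherAT2002] A. Hatcher, Algebraic Topology, CUP 2002, §1.3 Prop. 1.39–1.40, §3.G.
* [Arapura2012] D. Arapura, Algebraic Geometry over the Complex Numbers, Springer 2012, §15.4 Cor. 15.4.6.
-/

set_option autoImplicit false

noncomputable section

open Matrix Function Set
open Literature.Geometry.ComplexHyperbolic
open Literature.Geometry.ComplexHyperbolic.BallModel
open Literature.AlgebraicGeometry.Motives (SchemeOver ComplexPoints AlgPoints IsSmoothProjective bettiCohomology)
open Literature.AlgebraicTopology.SingularHomology
open Literature.NumberTheory.Transcendental
open Literature.AlgebraicGeometry.HodgeTheory (HodgeModel exists_isReal_hodgeModel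
  hodgePQ_independent_of_hodgeModel)
open CategoryTheory

namespace Literature.AlgebraicGeometry.ShimuraVarieties.UnitaryBallLevelDeckCover

open Literature.AlgebraicGeometry.ShimuraVarieties UnitaryBallUniformisationDatum

variable {X₁ X₂ : SchemeOver ℂ} {D₁ : UnitaryBallUniformisationDatum 2 X₁}
  {D₂ : UnitaryBallUniformisationDatum 2 X₂}


/-! ### §1 The groups `Γ₁^{τ₁} ⊴ Γ₂^{τ₁} ≤ GL₃(ℂ)` acting on the common negative cone -/

/-- Elements of `Γ₂^{τ₁}` are isometries of the common hermitian space: `gᴴ H₁^{τ₁} g = H₁^{τ₁}` (`Γ₂ ⊆ U(V)(F)`,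
field `isCongruenceSubgroup`; `D₁.Hℂ = D₂.Hℂ`). [cite: BergeronMillsonMoeglin2016Balls, Part 2 §1.2] -/
theorem conjTranspose_mul_Hℂ_mul_of_mem_map (hH : D₁.Hℂ = D₂.Hℂ) {g : GL (Fin 3) ℂ}
    (hg : g ∈ D₂.Γ.map (Matrix.GeneralLinearGroup.map D₂.τ₁)) :
    (g : Matrix (Fin 3) (Fin 3) ℂ)ᴴ * D₁.Hℂ * (g : Matrix (Fin 3) (Fin 3) ℂ) = D₁.Hℂ := by
  obtain ⟨δ, hδ, rfl⟩ := Subgroup.mem_map.1 hg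
  rw [hH]
  exact D₂.conjTranspose_mul_Hℂ_mul (D₂.isCongruenceSubgroup.1 hδ)

/-- `Γ₂^{τ₁}` preserves the negative cone of `D₁` (it acts on the common ball).
[cite: BergeronMillsonMoeglin2016Balls, Part 2 §1.3] -/
theorem mulVec_mem_cone_of_mem_map (hH : D₁.Hℂ = D₂.Hℂ) {g : GL (Fin 3) ℂ}
    (hg : g ∈ D₂.Γ.map (Matrix.GeneralLinearGroup.map D₂.τ₁)) {v : Fin 3 → ℂ} (hv : v ∈ D₁.cone) :
    (g : Matrix (Fin 3) (Fin 3) ℂ) *ᵥ v ∈ D₁.cone :=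
  UnitaryBallHeckeTranslation.mulVec_mem_cone (D₂ := D₁) (conjTranspose_mul_Hℂ_mul_of_mem_map hH hg) hv

/-- `Γ₁^{τ₁}` acts trivially on `X₁(ℂ) = Γ₁\𝔹`: `unif₁ (n v) = unif₁ v` for `n ∈ Γ₁^{τ₁}` (the fibres of `unif₁`
are the `Γ₁·ℂˣ`-orbits, field `unif_eq_unif_iff`). [cite: BergeronMillsonMoeglin2016Balls, Introduction §1.1] -/
theorem unif_mulVec_of_mem_map {n : GL (Fin 3) ℂ} (hn : n ∈ D₁.Γ.map (Matrix.GeneralLinearGroup.map D₁.τ₁))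
    {v : Fin 3 → ℂ} (hv : v ∈ D₁.cone) : D₁.unif ((n : Matrix (Fin 3) (Fin 3) ℂ) *ᵥ v) = D₁.unif v := by
  obtain ⟨δ, hδ, rfl⟩ := Subgroup.mem_map.1 hn
  have hnv : ((Matrix.GeneralLinearGroup.map D₁.τ₁ δ : GL (Fin 3) ℂ) : Matrix (Fin 3) (Fin 3) ℂ) *ᵥ v ∈
      D₁.cone := D₁.act_mem_cone hδ hv
  refine (D₁.unif_eq_unif_iff _ hnv v hv).2 ⟨δ⁻¹, inv_mem hδ, 1, one_ne_zero, ?_⟩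
  rw [one_smul, mulVec_mulVec]
  change ((↑(δ⁻¹) : Matrix (Fin 3) (Fin 3) D₁.E).map D₁.τ₁ * (↑δ : Matrix (Fin 3) (Fin 3) D₁.E).map D₁.τ₁) *ᵥ v = v
  rw [← Matrix.map_mul, Units.inv_mul, Matrix.map_one D₁.τ₁ (map_zero _) (map_one _), one_mulVec]

/-- Normality read on `GL₃(ℂ)`: for `Γ₁^{τ₁} ≤ Γ₂^{τ₁}` with `Γ₁^{τ₁}` normal in `Γ₂^{τ₁}`, conjugation by
`γ ∈ Γ₂^{τ₁}` maps `Γ₁^{τ₁}` into itself. [cite: Shimura1971, §3.1] -/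
theorem map_conj_le_of_normal
    (hle : D₁.Γ.map (Matrix.GeneralLinearGroup.map D₁.τ₁) ≤ D₂.Γ.map (Matrix.GeneralLinearGroup.map D₂.τ₁))
    [hN : ((D₁.Γ.map (Matrix.GeneralLinearGroup.map D₁.τ₁)).subgroupOf
      (D₂.Γ.map (Matrix.GeneralLinearGroup.map D₂.τ₁))).Normal]
    {γ : GL (Fin 3) ℂ} (hγ : γ ∈ D₂.Γ.map (Matrix.GeneralLinearGroup.map D₂.τ₁)) :
    (D₁.Γ.map (Matrix.GeneralLinearGroup.map D₁.τ₁)).map (MulAut.conj γ).toMonoidHom ≤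
      D₁.Γ.map (Matrix.GeneralLinearGroup.map D₁.τ₁) := by
  rintro _ ⟨n, hn, rfl⟩
  have h := hN.conj_mem ⟨n, hle hn⟩ (Subgroup.mem_subgroupOf.2 hn) ⟨γ, hγ⟩
  rw [Subgroup.mem_subgroupOf] at h
  exact h

/-- **Translates by congruent elements coincide on `X₁(ℂ)`**: if `γ, γ' ∈ Γ₂^{τ₁}` with `γ⁻¹ γ' ∈ Γ₁^{τ₁}`
(`Γ₁^{τ₁} ⊴ Γ₂^{τ₁}`), then `unif₁ (γ v) = unif₁ (γ' v)`: `γ' v = γ (n v)` with `unif₁ (n v) = unif₁ v`, and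
`v ↦ unif₁ (γ v)` is constant on the fibres of `unif₁` (tree `UnitaryBallHeckeTranslation.unif_mulVec_eq_of_unif_eq`,
using `γ Γ₁^{τ₁} γ⁻¹ = Γ₁^{τ₁}`). [cite: Shimura1971, §3.1 and §7.2–7.3] [cite: HatcherAT2002, §1.3 Prop. 1.39] -/
theorem unif_mulVec_eq_of_inv_mul_mem (hH : D₁.Hℂ = D₂.Hℂ)
    (hle : D₁.Γ.map (Matrix.GeneralLinearGroup.map D₁.τ₁) ≤ D₂.Γ.map (Matrix.GeneralLinearGroup.map D₂.τ₁))
    [hN : ((D₁.Γ.map (Matrix.GeneralLinearGroup.map D₁.τ₁)).subgroupOf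
      (D₂.Γ.map (Matrix.GeneralLinearGroup.map D₂.τ₁))).Normal]
    {γ γ' : GL (Fin 3) ℂ} (hγ : γ ∈ D₂.Γ.map (Matrix.GeneralLinearGroup.map D₂.τ₁))
    (h : γ⁻¹ * γ' ∈ D₁.Γ.map (Matrix.GeneralLinearGroup.map D₁.τ₁)) {v : Fin 3 → ℂ} (hv : v ∈ D₁.cone) :
    D₁.unif ((γ : Matrix (Fin 3) (Fin 3) ℂ) *ᵥ v) = D₁.unif ((γ' : Matrix (Fin 3) (Fin 3) ℂ) *ᵥ v) := by
  have hγ' : γ' = γ * (γ⁻¹ * γ') := (mul_inv_cancel_left γ γ').symm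
  have hnv : ((γ⁻¹ * γ' : GL (Fin 3) ℂ) : Matrix (Fin 3) (Fin 3) ℂ) *ᵥ v ∈ D₁.cone :=
    mulVec_mem_cone_of_mem_map hH (hle h) hv
  rw [hγ', Units.val_mul, ← mulVec_mulVec]
  exact (UnitaryBallHeckeTranslation.unif_mulVec_eq_of_unif_eq (D₂ := D₁)
    (conjTranspose_mul_Hℂ_mul_of_mem_map hH hγ) (map_conj_le_of_normal hle hγ) hnv hv
    (unif_mulVec_of_mem_map h hv)).symm

/-! ### §2 The Hecke translations by `Γ₂^{τ₁}` are algebraic automorphisms of `X₁` -/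

/-- **The translation `[v] ↦ [γ v]` of `X₁(ℂ) = Γ₁\𝔹` by `γ ∈ Γ₂^{τ₁}` is (the map on complex points of) a
morphism `φ : X₁ ⟶ X₁`**, for `Γ₁^{τ₁} ⊴ Γ₂^{τ₁}`: the tree's `UnitaryBallHeckeTranslation.exists_hom_map_unif_mulVec_eq`
for the isometry `γ` conjugating `Γ₁^{τ₁}` into itself (record `Arapura2012_Cor_15_4_6`: holomorphic maps of
smooth projective varieties are algebraic). [cite: Shimura1971, §7.2–7.3] [cite: Arapura2012, §15.4 Cor. 15.4.6]
[cite: BergeronMillsonMoeglin2016Balls, Part 2 §1.8] -/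
theorem exists_hom_map_unif_mulVec_eq_of_mem_map (hH : D₁.Hℂ = D₂.Hℂ)
    (hle : D₁.Γ.map (Matrix.GeneralLinearGroup.map D₁.τ₁) ≤ D₂.Γ.map (Matrix.GeneralLinearGroup.map D₂.τ₁))
    [hN : ((D₁.Γ.map (Matrix.GeneralLinearGroup.map D₁.τ₁)).subgroupOf
      (D₂.Γ.map (Matrix.GeneralLinearGroup.map D₂.τ₁))).Normal]
    (hA : Arapura2012_Cor_15_4_6) (hA₁ : Nonempty (HodgeModel 2 X₁))
    {γ : GL (Fin 3) ℂ} (hγ : γ ∈ D₂.Γ.map (Matrix.GeneralLinearGroup.map D₂.τ₁)) :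
    ∃ φ : X₁ ⟶ X₁, ∀ v ∈ D₁.cone,
      AlgPoints.map φ (D₁.unif v) = D₁.unif ((γ : Matrix (Fin 3) (Fin 3) ℂ) *ᵥ v) :=
  UnitaryBallHeckeTranslation.exists_hom_map_unif_mulVec_eq_of_nonempty hA hA₁ hA₁
    (conjTranspose_mul_Hℂ_mul_of_mem_map hH hγ) (map_conj_le_of_normal hle hγ)

/-! ### §3 The level covering is a finite regular covering with deck group `Γ₂^{τ₁}/Γ₁^{τ₁}` -/

/-- **A normal level pair is a finite regular covering with algebraic deck transformations.**  For
`D₁.Hℂ = D₂.Hℂ`, subgroups `Γ₁' = Γ₁^{τ₁} ≤ Γ₂' = Γ₂^{τ₁}` of `GL₃(ℂ)` with `Γ₁'` normal in `Γ₂'` and finite quotient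
`G = Γ₂'/Γ₁'`, and the level covering `f : X₁ ⟶ X₂` (`f(ℂ)(unif₁ v) = unif₂ v`), there are an action of `G` on
`X₁(ℂ)` and a `FiniteDeckCover G X₁(ℂ) X₂(ℂ)` structure with projection `f(ℂ)` such that (i) every deck
transformation is `φ(ℂ)` for an algebraic `φ : X₁ ⟶ X₁` and (ii) `[γ] · unif₁ v = unif₁ (γ v)` for `γ ∈ Γ₂'`, `v` in
the cone.  Proof: the action is `[γ] · P := φ_γ(ℂ)(P)` for the Hecke translation `φ_γ` of a representative
(`exists_hom_map_unif_mulVec_eq_of_mem_map`; independent of the representative by `unif_mulVec_eq_of_inv_mul_mem`);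
`f(ℂ)` is a covering map and onto (`isCoveringMap_of_unif_comp`, `surjective_of_unif_comp`); `f(ℂ)([γ] · P) = f(ℂ)(P)`
since `unif₂ (γ v) = unif₂ v` for `γ ∈ Γ₂^{τ₁}`; transitivity on fibres: `unif₂ v' = unif₂ v` gives `γ v' = c v` with
`γ ∈ Γ₂`, so `unif₁ v' = unif₁ (γ⁻¹ v) = [γ⁻¹] · unif₁ v` (Hatcher Prop. 1.39–1.40: `Γ₁\𝔹 → Γ₂\𝔹` is normal with
group `Γ₂/Γ₁`). [cite: HatcherAT2002, §1.3 Prop. 1.39–1.40] [cite: Shimura1971, §3.1 and §7.2–7.3]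
[cite: BergeronMillsonMoeglin2016Balls, Introduction §1.1 and Part 2 §1.3, §1.8] [cite: Arapura2012, §15.4 Cor. 15.4.6] -/
theorem exists_finiteDeckCover (hH : D₁.Hℂ = D₂.Hℂ) {Γ₁' Γ₂' : Subgroup (GL (Fin 3) ℂ)}
    (hΓ₁ : D₁.Γ.map (Matrix.GeneralLinearGroup.map D₁.τ₁) = Γ₁')
    (hΓ₂ : D₂.Γ.map (Matrix.GeneralLinearGroup.map D₂.τ₁) = Γ₂')
    (hle : Γ₁' ≤ Γ₂') [hN : (Γ₁'.subgroupOf Γ₂').Normal] [Fintype (↥Γ₂' ⧸ Γ₁'.subgroupOf Γ₂')]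
    (hA : Arapura2012_Cor_15_4_6) (hA₁ : Nonempty (HodgeModel 2 X₁))
    (f : X₁ ⟶ X₂) (hf : ∀ v ∈ D₁.cone, AlgPoints.map f (D₁.unif v) = D₂.unif v) :
    ∃ (_ : MulAction (↥Γ₂' ⧸ Γ₁'.subgroupOf Γ₂') (ComplexPoints X₁))
      (c : FiniteDeckCover (↥Γ₂' ⧸ Γ₁'.subgroupOf Γ₂') (ComplexPoints X₁) (ComplexPoints X₂)),
      c.proj = AlgPoints.mapContinuous (L := ℂ) f ∧
      (∀ q, ∃ φ : X₁ ⟶ X₁, c.deck q = AlgPoints.mapContinuous (L := ℂ) φ) ∧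
      ∀ (γ : ↥Γ₂') (v : Fin 3 → ℂ), v ∈ D₁.cone →
        (QuotientGroup.mk γ : ↥Γ₂' ⧸ Γ₁'.subgroupOf Γ₂') • D₁.unif v =
          D₁.unif (((γ : GL (Fin 3) ℂ) : Matrix (Fin 3) (Fin 3) ℂ) *ᵥ v) := by
  classical
  -- the hypotheses read on the images `Γᵢ^{τ₁}` themselves
  have hle' : D₁.Γ.map (Matrix.GeneralLinearGroup.map D₁.τ₁) ≤ D₂.Γ.map (Matrix.GeneralLinearGroup.map D₂.τ₁) := by
    rw [hΓ₁, hΓ₂]; exact hle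
  haveI hN' : ((D₁.Γ.map (Matrix.GeneralLinearGroup.map D₁.τ₁)).subgroupOf
      (D₂.Γ.map (Matrix.GeneralLinearGroup.map D₂.τ₁))).Normal := by
    subst hΓ₁ hΓ₂; exact hN
  have hmem₂ : ∀ γ : ↥Γ₂', (γ : GL (Fin 3) ℂ) ∈ D₂.Γ.map (Matrix.GeneralLinearGroup.map D₂.τ₁) :=
    fun γ => by rw [hΓ₂]; exact γ.2
  have hmem₁ : ∀ {x : GL (Fin 3) ℂ}, x ∈ Γ₁' → x ∈ D₁.Γ.map (Matrix.GeneralLinearGroup.map D₁.τ₁) :=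
    fun hx => by rw [hΓ₁]; exact hx
  -- the algebraic Hecke translations by elements of `Γ₂^{τ₁}`
  have hex : ∀ γ : ↥Γ₂', ∃ φ : X₁ ⟶ X₁, ∀ v ∈ D₁.cone,
      AlgPoints.map φ (D₁.unif v) = D₁.unif (((γ : GL (Fin 3) ℂ) : Matrix (Fin 3) (Fin 3) ℂ) *ᵥ v) :=
    fun γ => exists_hom_map_unif_mulVec_eq_of_mem_map hH hle' hA hA₁ (hmem₂ γ)
  choose φ hφ using hex
  -- every point of `X₁(ℂ)` is uniformized
  have hsec : ∀ P : ComplexPoints X₁, ∃ v ∈ D₁.cone, D₁.unif v = P :=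
    fun P => D₁.surjOn_unif (mem_univ P)
  -- congruent representatives translate alike
  have hkey : ∀ γ γ' : ↥Γ₂', (QuotientGroup.mk γ : ↥Γ₂' ⧸ Γ₁'.subgroupOf Γ₂') = QuotientGroup.mk γ' →
      ∀ v ∈ D₁.cone, D₁.unif (((γ : GL (Fin 3) ℂ) : Matrix (Fin 3) (Fin 3) ℂ) *ᵥ v) =
        D₁.unif (((γ' : GL (Fin 3) ℂ) : Matrix (Fin 3) (Fin 3) ℂ) *ᵥ v) := by
    intro γ γ' h v hv
    have hmem : ((γ : GL (Fin 3) ℂ))⁻¹ * (γ' : GL (Fin 3) ℂ) ∈ D₁.Γ.map (Matrix.GeneralLinearGroup.map D₁.τ₁) :=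
      hmem₁ (Subgroup.mem_subgroupOf.1 (QuotientGroup.eq.1 h))
    exact unif_mulVec_eq_of_inv_mul_mem hH hle' (hmem₂ γ) hmem hv
  -- the action of `G = Γ₂^{τ₁}/Γ₁^{τ₁}` on `X₁(ℂ)` through chosen representatives
  letI inst : MulAction (↥Γ₂' ⧸ Γ₁'.subgroupOf Γ₂') (ComplexPoints X₁) :=
    { smul := fun q P => AlgPoints.map (φ q.out) P
      one_smul := fun P => by
        obtain ⟨v, hv, rfl⟩ := hsec P
        change AlgPoints.map (φ (1 : ↥Γ₂' ⧸ Γ₁'.subgroupOf Γ₂').out) (D₁.unif v) = D₁.unif v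
        rw [hφ _ v hv, hkey (1 : ↥Γ₂' ⧸ Γ₁'.subgroupOf Γ₂').out 1 (QuotientGroup.out_eq' _) v hv,
          OneMemClass.coe_one, Units.val_one, one_mulVec]
      mul_smul := fun q q' P => by
        obtain ⟨v, hv, rfl⟩ := hsec P
        change AlgPoints.map (φ (q * q').out) (D₁.unif v) =
          AlgPoints.map (φ q.out) (AlgPoints.map (φ q'.out) (D₁.unif v))
        have hv' : (((q'.out : ↥Γ₂') : GL (Fin 3) ℂ) : Matrix (Fin 3) (Fin 3) ℂ) *ᵥ v ∈ D₁.cone :=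
          mulVec_mem_cone_of_mem_map hH (hmem₂ q'.out) hv
        have hq : (QuotientGroup.mk (q * q').out : ↥Γ₂' ⧸ Γ₁'.subgroupOf Γ₂') =
            QuotientGroup.mk (q.out * q'.out) := by
          rw [QuotientGroup.mk_mul, QuotientGroup.out_eq', QuotientGroup.out_eq', QuotientGroup.out_eq']
        rw [hφ _ v hv, hφ q'.out v hv, hφ _ _ hv', mulVec_mulVec, hkey _ _ hq v hv, Subgroup.coe_mul,
          Units.val_mul] }
  have hsmul : ∀ (q : ↥Γ₂' ⧸ Γ₁'.subgroupOf Γ₂') (P : ComplexPoints X₁),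
      q • P = AlgPoints.map (φ q.out) P := fun _ _ => rfl
  -- `f(ℂ)` intertwines the uniformizations, as a bundled continuous map
  have hf' : ∀ v ∈ D₁.cone, AlgPoints.mapContinuous (L := ℂ) f (D₁.unif v) = D₂.unif v := hf
  -- the two data have the same negative cone
  have hcone : D₁.cone = D₂.cone := by
    change negCone D₁.Hℂ = negCone D₂.Hℂ
    rw [hH]
  refine ⟨inst,
    { proj := AlgPoints.mapContinuous (L := ℂ) f
      isCoveringMap_proj := isCoveringMap_of_unif_comp (D₁ := D₁) (D₂ := D₂) hH hf'
      surjective_proj := surjective_of_unif_comp (D₁ := D₁) (D₂ := D₂) hH hf'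
      continuous_smul := fun q => by
        simp_rw [hsmul q]
        exact (AlgPoints.mapContinuous (L := ℂ) (φ q.out)).continuous
      proj_smul := fun q P => by
        obtain ⟨v, hv, rfl⟩ := hsec P
        have hv' : (((q.out : ↥Γ₂') : GL (Fin 3) ℂ) : Matrix (Fin 3) (Fin 3) ℂ) *ᵥ v ∈ D₁.cone :=
          mulVec_mem_cone_of_mem_map hH (hmem₂ q.out) hv
        rw [hsmul, hφ _ v hv, hf' _ hv', hf' _ hv]
        exact unif_mulVec_of_mem_map (D₁ := D₂) (hmem₂ q.out) (hcone ▸ hv)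
      exists_smul_of_proj_eq := by
        intro P P' h
        obtain ⟨v, hv, rfl⟩ := hsec P
        obtain ⟨v', hv', rfl⟩ := hsec P'
        rw [hf' v hv, hf' v' hv'] at h
        have hv₂ : v ∈ D₂.cone := by rw [← hcone]; exact hv
        have hv'₂ : v' ∈ D₂.cone := by rw [← hcone]; exact hv'
        obtain ⟨δ, hδ, a, ha, hδv⟩ := (D₂.unif_eq_unif_iff v' hv'₂ v hv₂).1 h
        have hgmem : (Matrix.GeneralLinearGroup.map D₂.τ₁ δ : GL (Fin 3) ℂ) ∈ Γ₂' :=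
          hΓ₂ ▸ Subgroup.mem_map_of_mem _ hδ
        have hginv : (Matrix.GeneralLinearGroup.map D₂.τ₁ δ : GL (Fin 3) ℂ)⁻¹ ∈ Γ₂' := inv_mem hgmem
        refine ⟨QuotientGroup.mk ⟨(Matrix.GeneralLinearGroup.map D₂.τ₁ δ : GL (Fin 3) ℂ)⁻¹, hginv⟩, ?_⟩
        -- `v' = g⁻¹ (a • v)` for `g = δ^{τ₁}`
        have hv'eq : v' = (((Matrix.GeneralLinearGroup.map D₂.τ₁ δ : GL (Fin 3) ℂ)⁻¹ : GL (Fin 3) ℂ) :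
            Matrix (Fin 3) (Fin 3) ℂ) *ᵥ (a • v) := by
          have h1 : ((Matrix.GeneralLinearGroup.map D₂.τ₁ δ : GL (Fin 3) ℂ) : Matrix (Fin 3) (Fin 3) ℂ) *ᵥ v' =
              a • v := hδv
          rw [← h1, mulVec_mulVec, ← Units.val_mul, inv_mul_cancel, Units.val_one, one_mulVec]
        have hginvv : (((Matrix.GeneralLinearGroup.map D₂.τ₁ δ : GL (Fin 3) ℂ)⁻¹ : GL (Fin 3) ℂ) :
            Matrix (Fin 3) (Fin 3) ℂ) *ᵥ v ∈ D₁.cone :=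
          mulVec_mem_cone_of_mem_map hH (hmem₂ ⟨_, hginv⟩) hv
        rw [hsmul, hφ _ v hv, ← hkey ⟨_, hginv⟩ _ (QuotientGroup.out_eq' _).symm v hv, hv'eq,
          mulVec_smul, D₁.unif_smul ha hginvv] },
    rfl, fun q => ⟨φ q.out, ContinuousMap.ext fun P => rfl⟩, fun γ v hv => ?_⟩
  rw [hsmul, hφ _ v hv]
  exact hkey _ _ (QuotientGroup.out_eq' _) v hv

/-! ### §4 Consequence: the transfer of the level covering and the Hecke-shaped operators are Hodge morphisms -/

/-- **The transfer of a normal level covering of compact ball quotients is a morphism of the Hodge structures of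
record, and every Hecke-shaped operator `τ^* ∘ f₂^*` is a Hodge endomorphism.**  For `D₁.Hℂ = D₂.Hℂ`,
`Γ₁' = Γ₁^{τ₁} ⊴ Γ₂' = Γ₂^{τ₁}` with finite quotient `G`, and the level covering `f : X₁ ⟶ X₂`: there are an action of
`G` on `X₁(ℂ)` and a `FiniteDeckCover G X₁(ℂ) X₂(ℂ)` structure `c` with projection `f(ℂ)` (`exists_finiteDeckCover`)
such that, for every degree `k`, the transfer `τ^* = c.transferMap k : Hᵏ(X₁(ℂ); ℚ) → Hᵏ(X₂(ℂ); ℚ)` maps `Fᵖ Hᵏ(X₁)`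
into `Fᵖ Hᵏ(X₂)` (Hodge structures of record `BettiUniverse.hodge hHD _ k`), and for every morphism `f₂ : X₁ ⟶ X₂`
the operator `τ^* ∘ f₂^*` lies in `End_Hdg(Hᵏ(X₂(ℂ); ℚ))` — by `HodgeTheory/FiniteDeckTransferHodge`
(`BettiUniverse.transferMap_hodge`, `transferMap_comp_pull_mem_endAlg`), the deck transformations being algebraic.
With `f₂ =` the Hecke translation `[v] ↦ [g v] : X₁ ⟶ X₂` (tree `UnitaryBallHeckeTranslation`) this is the
Hodge-compatibility of the Hecke correspondence operator `T_g` on the `ℚ`-Hodge structure of record — the hypothesis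
`hH` of `Motives.HodgeStructure.Polarization.isSemisimple_apply`.  (`hHD`, `hI`: the tree theorems
`exists_isReal_hodgeModel_holds`, `hodgePQ_independent_of_hodgeModel_holds`.)
[cite: BergeronMillsonMoeglin2016Balls, Part 2 §1.8] [cite: Shimura1971, §7.2–7.3 and §8.3]
[cite: HatcherAT2002, §3.G p. 321] [cite: Arapura2012, §15.4 Cor. 15.4.6] -/
theorem exists_finiteDeckCover_transferMap_hodge (hHD : exists_isReal_hodgeModel)
    (hI : hodgePQ_independent_of_hodgeModel) (hH : D₁.Hℂ = D₂.Hℂ) {Γ₁' Γ₂' : Subgroup (GL (Fin 3) ℂ)}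
    (hΓ₁ : D₁.Γ.map (Matrix.GeneralLinearGroup.map D₁.τ₁) = Γ₁')
    (hΓ₂ : D₂.Γ.map (Matrix.GeneralLinearGroup.map D₂.τ₁) = Γ₂')
    (hle : Γ₁' ≤ Γ₂') [hN : (Γ₁'.subgroupOf Γ₂').Normal] [Fintype (↥Γ₂' ⧸ Γ₁'.subgroupOf Γ₂')]
    (hA : Arapura2012_Cor_15_4_6)
    (f : X₁ ⟶ X₂) (hf : ∀ v ∈ D₁.cone, AlgPoints.map f (D₁.unif v) = D₂.unif v) :
    ∃ (_ : MulAction (↥Γ₂' ⧸ Γ₁'.subgroupOf Γ₂') (ComplexPoints X₁))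
      (c : FiniteDeckCover (↥Γ₂' ⧸ Γ₁'.subgroupOf Γ₂') (ComplexPoints X₁) (ComplexPoints X₂)),
      c.proj = AlgPoints.mapContinuous (L := ℂ) f ∧
      (∀ (k : ℕ) (p : ℤ),
        ((Literature.AlgebraicGeometry.HodgeTheory.BettiUniverse.hodge hHD D₁.isSmoothProjective k).F p).map
            (((c.transferMap (R := ℚ) k).hom).baseChange ℂ) ≤
          (Literature.AlgebraicGeometry.HodgeTheory.BettiUniverse.hodge hHD D₂.isSmoothProjective k).F p) ∧
      (∀ (k : ℕ) (f₂ : X₁ ⟶ X₂),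
        (c.transferMap (R := ℚ) k).hom ∘ₗ Literature.AlgebraicGeometry.HodgeTheory.BettiUniverse.pull f₂ k ∈
          (Literature.AlgebraicGeometry.HodgeTheory.BettiUniverse.hodge hHD D₂.isSmoothProjective k).endAlg) ∧
      ∀ (γ : ↥Γ₂') (v : Fin 3 → ℂ), v ∈ D₁.cone →
        (QuotientGroup.mk γ : ↥Γ₂' ⧸ Γ₁'.subgroupOf Γ₂') • D₁.unif v =
          D₁.unif (((γ : GL (Fin 3) ℂ) : Matrix (Fin 3) (Fin 3) ℂ) *ᵥ v) := by
  obtain ⟨inst, c, hproj, hdeck, hact⟩ := exists_finiteDeckCover hH hΓ₁ hΓ₂ hle hA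
    ⟨Literature.AlgebraicGeometry.HodgeTheory.BettiUniverse.realHodgeModel hHD D₁.isSmoothProjective⟩ f hf
  choose φ hφ using hdeck
  exact ⟨inst, c, hproj,
    fun k p => Literature.AlgebraicGeometry.HodgeTheory.BettiUniverse.transferMap_hodge hHD hI
      D₁.isSmoothProjective D₂.isSmoothProjective c f hproj φ hφ k p,
    fun k f₂ => Literature.AlgebraicGeometry.HodgeTheory.BettiUniverse.transferMap_comp_pull_mem_endAlg hHD hI
      D₁.isSmoothProjective D₂.isSmoothProjective c f hproj φ hφ k f₂,
    hact⟩

end Literature.AlgebraicGeometry.ShimuraVarieties.UnitaryBallLevelDeckCover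

end
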